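import Summits.QuantumFields.YangMills.Theorems.UV3UnitEnvelopeSlackOfMassEnvelope
import Summits.QuantumFields.YangMills.Theorems.UnitScaleTiltPinnedHeightTailDoorExpSlack
import Summits.QuantumFields.YangMills.Theorems.UnitScaleTiltHistoryTailOfPackageMassEnvelope
import HarnessLib

/-!
# R3 (cell `ym3-torus`, YM₃ on T³ — a ladder RUNG, NOT d = 4, NOT infinite volume, NOT a mass gap, NOT the Clay problem) — **THE 19936 CRUX FACE OVER hTop♭:
# `UnitScaleTilt.HistoryTailL` FROM THE GUARDED v1 (α) SOCKET, THE POLYMER FIELDS, THE MAIN-TERM ROW AND THE TOP-LEVEL KINEMATIC LETTER WITH A RUN-LINEAR EXPONENT**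
# — the twin of w3 g19's ✓`UnitScaleTiltHistoryTailOfPackageTopPartialIterates` (face over hTop, ONE `c` for all runs) under the WEAKER display hTop♭ «`(dU_j)∘(Ū_{K−1}∘⋯∘Ū_j)⁻¹ ≤
# e^{c₀ + c₁·K}·dU_K`», through LEAD's exp-slack door ✓`UnitScaleTiltPinnedHeightTailDoorExpSlack.pinnedHeightTail_of_exp'` (K-24)

Seat `ym-ust-19936-w5` g18 (WIDTH-5 helper on stmt-QuantumFields-19936 `HistoryTailL`; NO claim on crux ∕ stub ∕ registry; LEAD ★w1 g11 01:14:11Z «w5: GO U♭ + the guarded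
crux face over hTop♭»).  THEOREMS ONLY (0 `def`, 0 `sorry`); `--supports stmt-QuantumFields-19936 --as helper`; count-neutral; CONDITIONAL — closes nothing.

THE CHAIN (all by name).  S side: `ym-ust-19936-w8` g11's guarded S-face ✓`stub_pinnedStepV3_of_package_of_purePinTop_of_main' (hpkg)(π)(hMain)(hPinA)` with `hPinA` from
px8 g11's S-KNIT ✓`hPinA_of_pinnedLF (π)(hSii)` and `hSii` from ✓`UV3PinnedStepOrganOfGrowingPartialIterates.hSii_forall_of_growingTopHaarPushforward (hTop♭)` (the run-linear
exponent eaten by the `β^A` slot, ✓`UV3PinnedStepOrganOfGrowingMassEnvelope`); U side: §1 `unitEnvelopeExp_forall_of_growingTopHaarPushforward_of_main` — the `∀ L` edition of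
✓`AlphaInputsT3AC.Of.unitEnvelopeExp_of_growingTopHaarPushforward_of_main` (`ρ_K ≤ e^{A₂K}·(e^{Cl}·Z_K)` a.e., the `hLowExp` letter); door: K-24 ✓`pinnedHeightTail_of_exp'`
(`e^{A₂K} ≤ e^{A₂m}·β_{K−j}^{⌈A₂m∕log L⌉₊}` at the constrained heights); socket: ✓p748552 `historyTailL_of_pinnedHeightTail_freeRate`.

CONTENTS: §1 `growingTopHaarPushforward_of_growingTopBlockAvgPushforward` (the `blockAvg ℰp` spelling ⟹ hTop♭), ★★ `unitEnvelopeExp_forall_of_growingTopHaarPushforward_of_main`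
(the `∀ L` U letter with exponential slack, guarded socket); §2 ★★★ `pinnedHeightTail_of_package_of_growingTopHaarPushforward_of_main` (`hP′` VERBATIM), ★★★★
`historyTailL_of_package_of_growingTopHaarPushforward_of_main (hpkg)(π)(hMain)(hTop♭) : …Theses.UnitScaleTilt.HistoryTailL`, ★★★
`historyTailL_of_package_of_growingTopBlockAvgPushforward_of_main` (hTop♭ with the cruxes' `blockAvg ℰp` family spelled out).  w3 g19's face over hTop
(✓`UnitScaleTiltHistoryTailOfPackageTopPartialIterates.historyTailL_of_package_of_topHaarPushforward_of_main`) is the special case hTop ⟹ hTop♭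
(✓`UV3PinnedStepOrganOfGrowingPartialIterates.growingTopHaarPushforward_of_topHaarPushforward`, `c₁ := 0`) — not restated here (gate dedup); the new display is WEAKER.

FOUR displayed rows: `hpkg` (the UV3 node's (α) input package, guarded per ★★OWNER RULING №38), `π` (a parameter), `hMain` (EX lane), hTop♭ «for every three-torus family there are
`c₀, c₁` with: at every run `K`, every segment of the family's block averaging ending at the unit torus pushes Haar to at most `e^{c₀ + c₁·K}`·Haar» — the N08 loop part with ONE
non-decaying defect per RG level tolerated (laundering borderline `θ = L⁻³`), OPEN for `blockAvg ℰp`.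

HONEST SCOPE.  Bookkeeping; CONDITIONAL; nothing of hTop♭, `hMain`, the (α) package, `stub_pinnedStep`, `stub_unitEnvelope`, `hP′`, `HistoryTailL` (19936), the rung `YM3TorusSU2`,
any continuum limit, d = 4, a mass gap or Clay is proved here; no summit statement is proved by this seat.  R3 = YM₃ on T³, a rung — NOT the Clay problem.

References: T. Bałaban, Commun. Math. Phys. **102** (1985) 255–275 [Balaban1985UV3] (Thm 1 (5) p.256, (2) p.256, (6)–(7) p.257, (41) p.266, (47) p.267, (67)–(71) p.273);
T. Bałaban, Commun. Math. Phys. **98** (1985) 17–51 [Balaban1985Averaging] ((15) p.19); T. Bałaban, Commun. Math. Phys. **109** (1987) 249–301 [Balaban1987RG1] ((0.4), (0.11) p.253).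
-/

set_option autoImplicit false

noncomputable section

namespace Summit.QuantumFields.YangMills.Theorems.UnitScaleTiltHistoryTailOfPackageGrowingTopPartialIterates

open scoped BigOperators ENNReal
open MeasureTheory
open Literature.MathematicalPhysics.QuantumFieldTheory.Balaban1983to89
open Literature.MathematicalPhysics.QuantumFieldTheory.Balaban1983to89.T4AvgSensitivity (iterFrom)
open Literature.MathematicalPhysics.QuantumFieldTheory.Balaban1983to89.T3ContinuumYM3Torus
open Literature.MathematicalPhysics.QuantumFieldTheory.Balaban1983to89.T3UnitScaleTilt
open Literature.MathematicalPhysics.QuantumFieldTheory.Balaban1983to89.T3UnitLawDensityEML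
open Literature.MathematicalPhysics.QuantumFieldTheory.Balaban1983to89.T3RestrictedUnitDensity
open Literature.MathematicalPhysics.QuantumFieldTheory.Balaban1983to89.T3CruxEstimates
open Literature.MathematicalPhysics.QuantumFieldTheory.Balaban1983to89.T3AlphaInputsAC
open Literature.MathematicalPhysics.QuantumFieldTheory.Balaban1983to89.Missing (partitionFn)
open Literature.MathematicalPhysics.QuantumFieldTheory.Balaban1985CMP102
open Literature.MathematicalPhysics.QuantumFieldTheory.Balaban1985CMP102.Setting
open Summit.QuantumFields.Balaban3D.Carriers
open Summit.QuantumFields.Balaban3D.Proofs.Primitives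
open Summit.QuantumFields.Balaban3D.Proofs.TowerAC
open Summit.QuantumFields.Balaban3D.Proofs.StandardAC
open Summit.QuantumFields.Balaban3D.Proofs.InputsAC
open Summit.QuantumFields.YangMills.Theorems.UV3PinnedStepKnitOfPackage (hPinA_of_pinnedLF)
open Summit.QuantumFields.YangMills.Theorems.UV3PinnedStepOrganOfTopPartialIterates (iterFrom_avT3_eq_iterFrom_blockAvg)
open Summit.QuantumFields.YangMills.Theorems.UV3PinnedStepOrganOfGrowingPartialIterates (hSii_forall_of_growingTopHaarPushforward)
open Summit.QuantumFields.YangMills.Theorems.UnitScaleTiltPinnedHeightTailDoorExpSlack (pinnedHeightTail_of_exp')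
open Summit.QuantumFields.YangMills.Theorems.UnitScaleTiltHistoryTailOfPackageMassEnvelope (stub_pinnedStepV3_of_package_of_purePinTop_of_main')
open Summit.QuantumFields.YangMills.Theorems.UnitScaleTiltHistoryTailOfPinnedHeightTailFreeRate (historyTailL_of_pinnedHeightTail_freeRate)

/-! ## §1 hTop♭ from its `blockAvg ℰp` spelling; the `∀ L` unit-envelope letter with exponential slack -/

/-- **THE LETTER WITH `blockAvg ℰp` SPELLED OUT IMPLIES hTop♭** (per family): in range `j + n = K ≤ m + K` the composite of the pinned family IS the iterated block averaging
(✓`iterFrom_avT3_eq_iterFrom_blockAvg`). [cite: Balaban1987RG1, (0.4) + (0.11) p.253] -/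
theorem growingTopHaarPushforward_of_growingTopBlockAvgPushforward (F : T3Family)
    (hTopB : ∃ c₀ c₁ : ℝ, ∀ (K j n : ℕ), j + n = K →
      (fieldMeasure (F.P K) j (Matrix.specialUnitaryGroup (Fin 2) ℂ)).map
          (iterFrom (fun i => BlockAveraging.blockAvg (P := F.P K) (G := Matrix.specialUnitaryGroup (Fin 2) ℂ) (j := i) ℰp) j n) ≤
        ENNReal.ofReal (Real.exp (c₀ + c₁ * (K : ℝ))) • fieldMeasure (F.P K) (j + n) (Matrix.specialUnitaryGroup (Fin 2) ℂ)) :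
    ∃ c₀ c₁ : ℝ, ∀ (K j n : ℕ), j + n = K →
      (fieldMeasure (F.P K) j (Matrix.specialUnitaryGroup (Fin 2) ℂ)).map (iterFrom (avT3 F K) j n) ≤
        ENNReal.ofReal (Real.exp (c₀ + c₁ * (K : ℝ))) • fieldMeasure (F.P K) (j + n) (Matrix.specialUnitaryGroup (Fin 2) ℂ) := by
  obtain ⟨c₀, c₁, hc⟩ := hTopB
  refine ⟨c₀, c₁, fun K j n hjn => ?_⟩
  rw [iterFrom_avT3_eq_iterFrom_blockAvg F K j n (by omega)]
  exact hc K j n hjn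

/-- ★★ **THE `∀ L` UNIT-ENVELOPE LETTER WITH EXPONENTIAL SLACK FROM THE GUARDED SOCKET, `π`, `hMain`, hTop♭** — ✓`AlphaInputsT3AC.Of.unitEnvelopeExp_of_growingTopHaarPushforward_of_main`
family by family at the socket's record for the block size (threshold `γ₁ := (min γ₀ 1)²`); `L ≤ 1` vacuous (`T3Family.hL`).  This is K-24's `hLowExp` hypothesis VERBATIM.
[cite: Balaban1985UV3, Thm 1 (5)–(6) pp.256–257, (41) p.266, (46)–(47) p.267] -/
theorem unitEnvelopeExp_forall_of_growingTopHaarPushforward_of_main (π : ∀ F : T3Family, AlphaInputsT3AC.PolymerT3 F)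
    (hpkg : ∀ L : ℕ, 1 < L → AlphaInputsT3AC L)
    (hMain : ∀ (F : T3Family) (𝔠 : AlphaConsts F.L (suGroupModel 2).N) (h : AlphaInputsT3AC.Of F 𝔠) (γ : ℝ) (hγ : 0 < γ)
      (hγ1 : γ ≤ (min 𝔠.gamma0 1) ^ 2), ∃ Cm : ℝ, ∀ (K : ℕ) (W : GaugeField (F.P K) K (Matrix.specialUnitaryGroup (Fin 2) ℂ)),
        PlaqSmall (θBal F.L γ 𝔠.b₀ 𝔠.p₀ 0) W →
          (h.dataT3 γ hγ hγ1 (π F)).mainT K K ((h.dataT3 γ hγ hγ1 (π F)).triv K K) W ≤ Cm)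
    (hTop : ∀ F : T3Family, ∃ c₀ c₁ : ℝ, ∀ (K j n : ℕ), j + n = K →
      (fieldMeasure (F.P K) j (Matrix.specialUnitaryGroup (Fin 2) ℂ)).map (iterFrom (avT3 F K) j n) ≤
        ENNReal.ofReal (Real.exp (c₀ + c₁ * (K : ℝ))) • fieldMeasure (F.P K) (j + n) (Matrix.specialUnitaryGroup (Fin 2) ℂ)) :
    ∀ (L : ℕ), ∃ γ₁ : ℝ, 0 < γ₁ ∧ ∀ (F : T3Family) (γ : ℝ), F.L = L → 0 < γ → γ ≤ γ₁ →
      ∃ (Cl A₂ : ℝ), 0 ≤ A₂ ∧ ∀ K : ℕ, ∀ᵐ V ∂(fieldMeasure (F.P K) K (Matrix.specialUnitaryGroup (Fin 2) ℂ)),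
        emlDensity F γ K K V ≤
          Real.exp (A₂ * K) * (Real.exp Cl * partitionFn (G := Matrix.specialUnitaryGroup (Fin 2) ℂ) (F.P K) ((F.scheme ℰp γ).β K)) := by
  intro L
  by_cases hL : 1 < L
  · obtain ⟨𝔠, h𝔠⟩ := hpkg L hL
    refine ⟨(min 𝔠.gamma0 1) ^ 2, pow_pos (lt_min 𝔠.gamma0_pos one_pos) 2, fun F γ hFL hγ hγle => ?_⟩
    subst hFL
    exact (h𝔠 F rfl).unitEnvelopeExp_of_growingTopHaarPushforward_of_main γ hγ hγle (π F) (hTop F) (hMain F 𝔠 (h𝔠 F rfl) γ hγ hγle)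
  · -- no three-torus family has block size `L ≤ 1`
    refine ⟨1, one_pos, fun F γ hFL _ _ => absurd (hFL ▸ F.hL.2) hL⟩

/-! ## §2 The pinned height tail and the crux by name, over hTop♭ -/

/-- ★★★ **THE PINNED HEIGHT TAIL `hP′` (the LEAD's K-19′ socket hypothesis, VERBATIM) FROM THE GUARDED SOCKET, `π`, `hMain` AND hTop♭.**  S side: the guarded S-face
✓`stub_pinnedStepV3_of_package_of_purePinTop_of_main' (hpkg)(π)(hMain)(hPinA)`, `hPinA` from ✓`hPinA_of_pinnedLF (π)(hSii)`, `hSii` from ✓`hSii_forall_of_growingTopHaarPushforward (hTop♭)`;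
U side: §1; door: K-24 ✓`pinnedHeightTail_of_exp'` (the factor `e^{A₂K}` absorbed by `e^{A₂K} ≤ e^{A₂m}·β_{K−j}^{⌈A₂m∕log L⌉₊}` at the constrained heights).
[cite: Balaban1985UV3, Thm 1 (5) p.256, (2) p.256, (6)–(7) p.257, (41) p.266, (47) p.267, (67)–(71) p.273; Balaban1987RG1, (0.11) p.253] -/
theorem pinnedHeightTail_of_package_of_growingTopHaarPushforward_of_main
    (hpkg : ∀ L : ℕ, 1 < L → AlphaInputsT3AC L)
    (π : ∀ F : T3Family, AlphaInputsT3AC.PolymerT3 F)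
    (hMain : ∀ (F : T3Family) (𝔠 : AlphaConsts F.L (suGroupModel 2).N) (h : AlphaInputsT3AC.Of F 𝔠) (γ : ℝ) (hγ : 0 < γ)
      (hγ1 : γ ≤ (min 𝔠.gamma0 1) ^ 2), ∃ Cm : ℝ, ∀ (K : ℕ) (W : GaugeField (F.P K) K (Matrix.specialUnitaryGroup (Fin 2) ℂ)),
        PlaqSmall (θBal F.L γ 𝔠.b₀ 𝔠.p₀ 0) W →
          (h.dataT3 γ hγ hγ1 (π F)).mainT K K ((h.dataT3 γ hγ hγ1 (π F)).triv K K) W ≤ Cm)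
    (hTop : ∀ F : T3Family, ∃ c₀ c₁ : ℝ, ∀ (K j n : ℕ), j + n = K →
      (fieldMeasure (F.P K) j (Matrix.specialUnitaryGroup (Fin 2) ℂ)).map (iterFrom (avT3 F K) j n) ≤
        ENNReal.ofReal (Real.exp (c₀ + c₁ * (K : ℝ))) • fieldMeasure (F.P K) (j + n) (Matrix.specialUnitaryGroup (Fin 2) ℂ)) :
    ∀ (L : ℕ), ∃ (b₁' p₁' : ℝ), ∀ (b₀ p₀ : ℝ), b₁' ≤ b₀ → p₁' ≤ p₀ → 0 < b₀ → 2 < p₀ → ∀ (m : ℕ), 0 < m →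
      ∃ γ₁ : ℝ, 0 < γ₁ ∧ γ₁ ≤ 1 ∧ ∀ (F : T3Family) (γ : ℝ), F.L = L → 0 < γ → γ ≤ γ₁ →
        ∃ (b p C c : ℝ) (A : ℕ), 0 < b ∧ 1 ≤ p ∧ 0 ≤ C ∧ 0 < c ∧
          ∀ (K j : ℕ), 1 ≤ j → j + 2 ≤ K → j + (K - 1) / m ≤ K → ∀ a : Plaq (F.P K) j,
          (gibbsK F ℰp γ K).real
              ({U : GaugeField (F.P K) 0 (Matrix.specialUnitaryGroup (Fin 2) ℂ) |
                  θBal F.L γ b₀ p₀ (K - j) ≤ GaugeGroup.dist1 (GaugeField.plaqHol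
                    (Averaging.iter (fun i' => BlockAveraging.blockAvg (P := F.P K) (j := i') ℰp) j U) a)} ∩
                {U : GaugeField (F.P K) 0 (Matrix.specialUnitaryGroup (Fin 2) ℂ) | ∀ i, i < j →
                  PlaqSmall (θBal F.L γ b₀ p₀ (K - i))
                    (Averaging.iter (fun i' => BlockAveraging.blockAvg (P := F.P K) (j := i') ℰp) i U)}) ≤
            C * (F.scheme ℰp γ).β (K - j) ^ A *
              Real.exp (-(c * B10.pFun b p (Real.sqrt (γ * ((F.L : ℝ)⁻¹) ^ (K - j))) ^ 2)) :=
  pinnedHeightTail_of_exp'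
    (stub_pinnedStepV3_of_package_of_purePinTop_of_main' hpkg π hMain
      (hPinA_of_pinnedLF π (hSii_forall_of_growingTopHaarPushforward hTop)))
    (unitEnvelopeExp_forall_of_growingTopHaarPushforward_of_main π hpkg hMain hTop)

/-- ★★★★ **`UnitScaleTilt.HistoryTailL` (stmt-QuantumFields-19936) FROM THE GUARDED v1 (α) SOCKET, THE POLYMER FIELDS, THE MAIN-TERM ROW AND hTop♭** — the previous theorem
through the LEAD socket ✓p748552 `historyTailL_of_pinnedHeightTail_freeRate`, one `exact`.  FOUR displayed rows: `hpkg` (the UV3 node's (α) input package, guarded), `π` (a parameter),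
`hMain` (EX lane), hTop♭ (Haar pushed through the `K`-fold block averaging ONTO THE UNIT TORUS has density `≤ e^{c₀ + c₁·K}` — one constant per RG step, not K-uniform).  WEAKER than
w3 g19's face over hTop (hTop ⟹ hTop♭).  CONDITIONAL: closes nothing.  R3 = YM₃ on T³, a rung — NOT d = 4, NOT infinite volume, NOT a mass gap, NOT Clay.
[cite: Balaban1985UV3, Thm 1 (5) p.256, (2) p.256, (41) p.266, (47) p.267, (67)–(71) p.273; Balaban1985Averaging, (15) p.19; Balaban1987RG1, (0.11) p.253] -/
theorem historyTailL_of_package_of_growingTopHaarPushforward_of_main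
    (hpkg : ∀ L : ℕ, 1 < L → AlphaInputsT3AC L)
    (π : ∀ F : T3Family, AlphaInputsT3AC.PolymerT3 F)
    (hMain : ∀ (F : T3Family) (𝔠 : AlphaConsts F.L (suGroupModel 2).N) (h : AlphaInputsT3AC.Of F 𝔠) (γ : ℝ) (hγ : 0 < γ)
      (hγ1 : γ ≤ (min 𝔠.gamma0 1) ^ 2), ∃ Cm : ℝ, ∀ (K : ℕ) (W : GaugeField (F.P K) K (Matrix.specialUnitaryGroup (Fin 2) ℂ)),
        PlaqSmall (θBal F.L γ 𝔠.b₀ 𝔠.p₀ 0) W →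
          (h.dataT3 γ hγ hγ1 (π F)).mainT K K ((h.dataT3 γ hγ hγ1 (π F)).triv K K) W ≤ Cm)
    (hTop : ∀ F : T3Family, ∃ c₀ c₁ : ℝ, ∀ (K j n : ℕ), j + n = K →
      (fieldMeasure (F.P K) j (Matrix.specialUnitaryGroup (Fin 2) ℂ)).map (iterFrom (avT3 F K) j n) ≤
        ENNReal.ofReal (Real.exp (c₀ + c₁ * (K : ℝ))) • fieldMeasure (F.P K) (j + n) (Matrix.specialUnitaryGroup (Fin 2) ℂ)) :
    Summit.QuantumFields.YangMills.Theses.UnitScaleTilt.HistoryTailL :=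
  historyTailL_of_pinnedHeightTail_freeRate (pinnedHeightTail_of_package_of_growingTopHaarPushforward_of_main hpkg π hMain hTop)

/-- ★★★ **`UnitScaleTilt.HistoryTailL` FROM THE GUARDED SOCKET, `π`, `hMain` AND THE RUN-LINEAR TOP-LEVEL LETTER WITH THE CRUXES' `blockAvg ℰp` FAMILY SPELLED OUT** —
«for every three-torus family there are `c₀, c₁` such that, at every run `K`, every segment `Ū_{K−1}∘⋯∘Ū_j` of the iterated block averaging `blockAvg ℰp` ending at the unit torus
pushes Haar to at most `e^{c₀ + c₁·K}`·Haar» (§1, then the face above). [cite: Balaban1985UV3, Thm 1 (5) p.256, (2) p.256, (41) p.266; Balaban1987RG1, (0.4) + (0.11) p.253] -/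
theorem historyTailL_of_package_of_growingTopBlockAvgPushforward_of_main
    (hpkg : ∀ L : ℕ, 1 < L → AlphaInputsT3AC L)
    (π : ∀ F : T3Family, AlphaInputsT3AC.PolymerT3 F)
    (hMain : ∀ (F : T3Family) (𝔠 : AlphaConsts F.L (suGroupModel 2).N) (h : AlphaInputsT3AC.Of F 𝔠) (γ : ℝ) (hγ : 0 < γ)
      (hγ1 : γ ≤ (min 𝔠.gamma0 1) ^ 2), ∃ Cm : ℝ, ∀ (K : ℕ) (W : GaugeField (F.P K) K (Matrix.specialUnitaryGroup (Fin 2) ℂ)),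
        PlaqSmall (θBal F.L γ 𝔠.b₀ 𝔠.p₀ 0) W →
          (h.dataT3 γ hγ hγ1 (π F)).mainT K K ((h.dataT3 γ hγ hγ1 (π F)).triv K K) W ≤ Cm)
    (hTopB : ∀ F : T3Family, ∃ c₀ c₁ : ℝ, ∀ (K j n : ℕ), j + n = K →
      (fieldMeasure (F.P K) j (Matrix.specialUnitaryGroup (Fin 2) ℂ)).map
          (iterFrom (fun i => BlockAveraging.blockAvg (P := F.P K) (G := Matrix.specialUnitaryGroup (Fin 2) ℂ) (j := i) ℰp) j n) ≤
        ENNReal.ofReal (Real.exp (c₀ + c₁ * (K : ℝ))) • fieldMeasure (F.P K) (j + n) (Matrix.specialUnitaryGroup (Fin 2) ℂ)) :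
    Summit.QuantumFields.YangMills.Theses.UnitScaleTilt.HistoryTailL :=
  historyTailL_of_package_of_growingTopHaarPushforward_of_main hpkg π hMain
    fun F => growingTopHaarPushforward_of_growingTopBlockAvgPushforward F (hTopB F)

end Summit.QuantumFields.YangMills.Theorems.UnitScaleTiltHistoryTailOfPackageGrowingTopPartialIterates

end
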